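import Mathlib
import HarnessLib
import Summits.HubbardSuperconductivity.HubbardSuperconductivity.Theorems.ComplexGFFStiffnessHypACumulantInitialNorm
import Literature.MathematicalPhysics.StatisticalMechanics.WeightedNormBounds

/-!
# Line `gnv`, stub `stub_gnvOfFrd`: the initial activity in the weighted-norm interface
# (ABKM19 Lemma 12.3, (12.18), `ι`-admissible complex class)

`Theorems/ComplexGFFStiffnessHypACumulantInitialNorm.lean` proved, for an `ι`-admissible perturbation
`K` of the `GNV` ball (`IsIotaAdmissible r₀ ρ K`), the pointwise bound
`‖∏_{x∈X} K(∇·(x))‖_{T_φ} ≤ (ρ e^{𝔥/R})^{|X|} · exp(¼ Σ_{x∈X} |∇φ(x)|²)` relative to the lattice gauge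
`fieldGauge 𝔥 R p S`, `X ⊆ S`.  This file restates it in the vocabulary of the weighted-norm interface
`Literature/…/WeightedNormBounds.lean` (`GradientRG.TayNormLE T r₀ w K C` = "`‖K‖_{T,w} ≤ C`"),
through which [ABKM19] Chs. 8–10 consume activities: with the SCALE-0 WEIGHT
`w_{-1:0}^X(φ) = exp(¼ Σ_{x∈X} |∇φ(x)|²)` ([ABKM19] (12.13) at `ζ = 1/2`, `𝒬 = |·|²`),

* `tayNormLE_pertActivity` — `‖I(K)(X)‖_{T_{𝔥,R,p,S}, w_{-1:0}^X} ≤ (ρ e^{𝔥/R})^{|X|}` ([ABKM19] (12.18));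
* `tayNormLE_pertSite` — the single-site case `X = {x}`;
* `pertWeight_union` — the weight FACTORISES over disjoint polymers (the (w3)-type property that
  `TayNormLE.mul`/`.prod` consume).

No new analysis; bookkeeping only (all proofs are one-liners over the landed estimate).
-/

noncomputable section

-- `Summit.<Summit>.<Problem>`: single-conjunct summit, the duplicate component is mandated (D-0017).
set_option linter.dupNamespace false

namespace Summit.HubbardSuperconductivity.HubbardSuperconductivity.Theorems.ComplexGFF

open Finset
open Literature.MathematicalPhysics.StatisticalMechanics.ComplexGradientGFF4 (D)
open Literature.MathematicalPhysics.StatisticalMechanics.GradientRG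
  (fieldGauge tayNorm TayNormLE)

variable {n : ℕ} [NeZero n]

omit [NeZero n] in
/-- **The scale-`0` weight factorises over disjoint polymers**:
`w^{X ∪ Y}(φ) = w^X(φ) · w^Y(φ)` for `w^X(φ) = exp(¼ Σ_{x∈X} |∇φ(x)|²)` and disjoint `X, Y`
(the scale-`0` case of [ABKM19] Theorem 7.1 (w3); the hypothesis of `TayNormLE.mul`). -/
theorem pertWeight_union {X Y : Finset (Fin 4 → ZMod n)} (h : Disjoint X Y)
    (φ : (Fin 4 → ZMod n) → ℝ) :
    Real.exp ((∑ x ∈ X ∪ Y, ∑ i : Fin 4, (D φ i x) ^ 2) / 4) =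
      Real.exp ((∑ x ∈ X, ∑ i : Fin 4, (D φ i x) ^ 2) / 4) *
        Real.exp ((∑ x ∈ Y, ∑ i : Fin 4, (D φ i x) ^ 2) / 4) := by
  rw [← Real.exp_add, Finset.sum_union h, add_div]

/-- **`‖I(K)(X)‖_{T, w_{-1:0}^X} ≤ (ρ e^{𝔥/R})^{|X|}`** ([ABKM19] Lemma 12.3 (12.18), on the complex
`ι`-admissible class): the polymer activity of `K` with `IsIotaAdmissible r₀ ρ K` is in the weighted
ball of the gauge `fieldGauge 𝔥 R p S` (`X ⊆ S`, `𝔥, R > 0`, `p ≥ 1`) with the scale-`0` weight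
`w_{-1:0}^X(φ) = exp(¼ Σ_{x∈X} |∇φ(x)|²)` ([ABKM19] (12.13), `ζ = 1/2`, `𝒬 = |·|²`). -/
theorem tayNormLE_pertActivity {r₀ : ℕ} {ρ : ℝ} {K : (Fin 4 → ℝ) → ℂ} (hK : IsIotaAdmissible r₀ ρ K)
    {𝔥 R : ℝ} (h𝔥 : 0 < 𝔥) (hR : 0 < R) {p : ℕ} (hp : 1 ≤ p) {S X : Finset (Fin 4 → ZMod n)}
    (hXS : X ⊆ S) :
    TayNormLE (fieldGauge 𝔥 R p S) r₀
      (fun φ : (Fin 4 → ZMod n) → ℝ => Real.exp ((∑ x ∈ X, ∑ i : Fin 4, (D φ i x) ^ 2) / 4))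
      (fun φ : (Fin 4 → ZMod n) → ℝ => ∏ x ∈ X, K (fun i => D φ i x))
      ((ρ * Real.exp (𝔥 / R)) ^ X.card) :=
  fun φ => tayNorm_pertActivity_le hK h𝔥 hR hp hXS φ

/-- The single-site case: `‖K(∇·(x))‖_{T, w_{-1:0}^{{x}}} ≤ ρ e^{𝔥/R}` ([ABKM19] (12.17)). -/
theorem tayNormLE_pertSite {r₀ : ℕ} {ρ : ℝ} {K : (Fin 4 → ℝ) → ℂ} (hK : IsIotaAdmissible r₀ ρ K)
    {𝔥 R : ℝ} (h𝔥 : 0 < 𝔥) (hR : 0 < R) {p : ℕ} (hp : 1 ≤ p) {S : Finset (Fin 4 → ZMod n)}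
    {x : Fin 4 → ZMod n} (hx : x ∈ S) :
    TayNormLE (fieldGauge 𝔥 R p S) r₀
      (fun φ : (Fin 4 → ZMod n) → ℝ => Real.exp ((∑ i : Fin 4, (D φ i x) ^ 2) / 4))
      (fun φ : (Fin 4 → ZMod n) → ℝ => K (fun i => D φ i x)) (ρ * Real.exp (𝔥 / R)) :=
  fun φ => tayNorm_pertSite_le hK h𝔥 hR hp hx φ

end Summit.HubbardSuperconductivity.HubbardSuperconductivity.Theorems.ComplexGFF

end
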